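import Summits.HubbardSuperconductivity.HubbardSuperconductivity.Theorems.NodalWardXYPerturbedXYOrderChargedShift

/-!
# `PerturbedXYOrder` (stmt-HubbardSuperconductivity-10739) — line `schwarz-inheritance`, stub `stub_rotatorWardIdentity`

Tools for the second NEGATIVE stub of lead c18, `stub_chargedEnergyTiltPinching` (the RELATIVELY BOUNDED charged tilt of the rotator is
not uniformly zero-free either — `Theorems/PerturbedXYOrder/Negative/ChargedEnergyTiltPinching.lean`), over the vocabulary of
`Theorems/NodalWardXYDefs.lean`:

* §A `cfw_setIntegral_rotate` — Lebesgue measure on the angle cube `[0,2π]^Λ` is invariant under an arbitrary site-dependent rotation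
  `θ ↦ θ + c` against functions of the spins `e^{iθ_x}` (transfer to the torus `U(1)^Λ`, `setIntegral_angleCube_comp_exp`, and Haar
  invariance `integral_torusHaar_mul_right`);
* §B `cfw_setIntegral_deriv_eq_zero` — **integration by parts on the angle cube**: if `s ↦ G(e^{i(θ + s e_x)})` has derivative `D(θ)` at
  `s = 0` for every `θ`, with `D` continuous and bounded, then `∫_cube D = 0` (differentiate the constant function
  `s ↦ ∫_cube G(e^{i(θ + s e_x)}) dθ` under the integral sign, `hasDerivAt_integral_of_dominated_loc_of_deriv_le`);
* §C `stub_rotatorWardIdentity` (registered stub) — the **rotator Ward identity**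
  `∫_cube cos(θ_x − θ_y) w_J = J ∫_cube sin(θ_x − θ_y) S_x w_J` for `x ≠ y`, where `w_J = e^{J Σ_b cos ∇_bθ}` and
  `S_x = Σ_b sin(∇_bθ) (δ_{x,b₂} − δ_{x,b₁}) = −∂_{θ_x} Σ_b cos ∇_bθ` (`b = (b₁, b₁ + e_i)`): integration by parts of
  `∂_{θ_x}[sin(θ_x − θ_y) w_J]`.  Summed against the magnetisation it says that long-range order forces the bond currents at `x` to
  align with `θ_x − θ_y`: `J Σ_{x,y} ⟨sin(θ_x − θ_y) S_x⟩ = ⟨|M|²⟩ − N`.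
-/

noncomputable section

namespace Summit.HubbardSuperconductivity.HubbardSuperconductivity.Theorems.PerturbedXYOrder

open MeasureTheory Literature.Probability.LatticeModels Metric Set
open Summit.HubbardSuperconductivity.HubbardSuperconductivity.Theses.NodalWardXY

variable {L : ℕ}

/-! ### A. Rotations of the angle cube -/

/-- **Lebesgue measure on the angle cube is rotation invariant** against functions of the spins: for a continuous `G` on the torus
`U(1)^Λ` and any `c : Λ → ℝ`, `∫_cube G(e^{i(θ + c)}) dθ = ∫_cube G(e^{iθ}) dθ`. [folklore] -/
theorem cfw_setIntegral_rotate [NeZero L] {E : Type*} [NormedAddCommGroup E] [NormedSpace ℝ E]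
    (c : TorusSite 3 L → ℝ) {G : (TorusSite 3 L → Circle) → E} (hG : Continuous G) :
    ∫ θ in cube L, G (fun v => Circle.exp (θ v + c v)) = ∫ θ in cube L, G (fun v => Circle.exp (θ v)) := by
  set u : TorusSite 3 L → Circle := fun v => Circle.exp (c v) with hu
  have hGc' : Continuous fun z : TorusSite 3 L → Circle => G (z * u) := hG.comp (continuous_id.mul continuous_const)
  have hL : ∀ θ : TorusSite 3 L → ℝ, G (fun v => Circle.exp (θ v + c v)) = G ((fun v => Circle.exp (θ v)) * u) := by
    intro θ
    congr 1
    funext v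
    simp only [Pi.mul_apply, hu, Circle.exp_add]
  have h1 := setIntegral_angleCube_comp_exp (V := TorusSite 3 L) (fun z => G (z * u)) hGc'.aestronglyMeasurable
  have h2 := setIntegral_angleCube_comp_exp (V := TorusSite 3 L) G hG.aestronglyMeasurable
  rw [integral_torusHaar_mul_right] at h1
  calc ∫ θ in cube L, G (fun v => Circle.exp (θ v + c v))
      = ∫ θ in cube L, G ((fun v => Circle.exp (θ v)) * u) := integral_congr_ae (ae_of_all _ fun θ => hL θ)
    _ = (2 * Real.pi) ^ Fintype.card (TorusSite 3 L) • ∫ z, G z ∂torusHaar (TorusSite 3 L) := h1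
    _ = ∫ θ in cube L, G (fun v => Circle.exp (θ v)) := h2.symm

/-! ### B. Integration by parts on the angle cube -/

/-- **Integration by parts on the angle cube.** Let `G` be continuous on `U(1)^Λ` and suppose that for every `θ` the one-coordinate
rotation `s ↦ G(e^{i(θ + s e_x)})` has derivative `D(θ)` at `s = 0`, with `D` continuous and bounded. Then `∫_cube D(θ) dθ = 0`
(the rotated integral does not depend on `s`; differentiate under the integral sign). [folklore] -/
theorem cfw_setIntegral_deriv_eq_zero [NeZero L] (x : TorusSite 3 L) {G : (TorusSite 3 L → Circle) → ℝ} (hG : Continuous G)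
    {D : (TorusSite 3 L → ℝ) → ℝ} (hD : Continuous D) {K : ℝ} (hK : ∀ θ, |D θ| ≤ K)
    (hderiv : ∀ θ : TorusSite 3 L → ℝ,
      HasDerivAt (fun s : ℝ => G (fun v => Circle.exp (θ v + s * (Pi.single x (1 : ℝ) : TorusSite 3 L → ℝ) v))) (D θ) 0) :
    ∫ θ in cube L, D θ = 0 := by
  set e : TorusSite 3 L → ℝ := Pi.single x (1 : ℝ) with he
  set F : ℝ → (TorusSite 3 L → ℝ) → ℝ := fun s θ => G (fun v => Circle.exp (θ v + s * e v)) with hF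
  set F' : ℝ → (TorusSite 3 L → ℝ) → ℝ := fun s θ => D (fun v => θ v + s * e v) with hF'
  haveI := ent_isFiniteMeasure_restrict_cube (L := L)
  -- the rotated integral is constant
  have hconst : ∀ s : ℝ, ∫ θ in cube L, F s θ = ∫ θ in cube L, G (fun v => Circle.exp (θ v)) := by
    intro s
    exact cfw_setIntegral_rotate (fun v => s * e v) hG
  -- continuity / measurability
  have hFc : ∀ s : ℝ, Continuous (F s) := by
    intro s
    refine hG.comp (continuous_pi fun v => Circle.exp.continuous.comp ?_)
    exact ((continuous_apply v).add continuous_const)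
  have hF'c : ∀ s : ℝ, Continuous (F' s) := by
    intro s
    refine hD.comp (continuous_pi fun v => (continuous_apply v).add continuous_const)
  -- pointwise derivative at every `s`
  have hdiff : ∀ (θ : TorusSite 3 L → ℝ) (s : ℝ), HasDerivAt (fun s' => F s' θ) (F' s θ) s := by
    intro θ s
    have h := hderiv (fun v => θ v + s * e v)
    -- reparametrise `s' = s + (s' - s)`
    have h1 : HasDerivAt (fun s' : ℝ => G (fun v => Circle.exp ((θ v + s * e v) + s' * e v))) (F' s θ) (s - s) := by
      rw [sub_self]; exact h
    have h2 : HasDerivAt (fun s' : ℝ => G (fun v => Circle.exp ((θ v + s * e v) + (s' - s) * e v))) (F' s θ) s :=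
      HasDerivAt.comp_sub_const s s h1
    refine h2.congr_of_eventuallyEq (Filter.Eventually.of_forall fun s' => ?_)
    simp only [hF]
    congr 1
    funext v
    congr 1
    ring
  have key := hasDerivAt_integral_of_dominated_loc_of_deriv_le (F := F) (F' := F') (x₀ := (0 : ℝ))
    (bound := fun _ => K) (s := Metric.ball (0 : ℝ) 1) (μ := volume.restrict (cube L))
    (Metric.ball_mem_nhds 0 one_pos)
    (Filter.Eventually.of_forall fun s => (hFc s).aestronglyMeasurable)
    ((hFc 0).continuousOn.integrableOn_compact ent_isCompact_cube)
    (hF'c 0).aestronglyMeasurable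
    (ae_of_all _ fun θ s _ => by
      rw [Real.norm_eq_abs]
      exact hK _)
    (integrable_const K)
    (ae_of_all _ fun θ s _ => hdiff θ s)
  have hD' : HasDerivAt (fun s => ∫ θ in cube L, F s θ) (∫ θ in cube L, F' 0 θ) 0 := key.2
  have hC : HasDerivAt (fun s => ∫ θ in cube L, F s θ) 0 0 := by
    have : (fun s => ∫ θ in cube L, F s θ) = fun _ => ∫ θ in cube L, G (fun v => Circle.exp (θ v)) := funext hconst
    rw [this]
    exact hasDerivAt_const _ _
  have huniq := hD'.unique hC
  have hF'0 : (fun θ => F' 0 θ) = D := by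
    funext θ
    simp only [hF', zero_mul, add_zero]
  rw [← hF'0]
  exact huniq

/-! ### C. The rotator Ward identity -/

/-- `Im(e^{-iθ_y} e^{iθ_x}) = sin(θ_x − θ_y)`. -/
theorem cfw_im_exp (a c : ℝ) : (((Circle.exp c)⁻¹ * Circle.exp a : Circle) : ℂ).im = Real.sin (a - c) := by
  rw [← Circle.exp_neg, ← Circle.exp_add, neg_add_eq_sub, Circle.coe_exp, Complex.exp_ofReal_mul_I_im]

/-- The real XY weight is the Ginibre weight of the bond characters at `e^{iθ}` (real form). -/
theorem cfw_ginibreWeight_exp [NeZero L] (J : ℝ) (θ : TorusSite 3 L → ℝ) :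
    ginibreWeight (fun b : Bond L => diffChar b.1 (b.1 + Pi.single b.2 1)) (fun _ => J) (fun v => Circle.exp (θ v)) =
      Real.exp (J * ∑ b : Bond L, Real.cos (θ (b.1 + Pi.single b.2 1) - θ b.1)) := by
  simp only [ginibreWeight, ginibreHamiltonian, reChar_diffChar_exp, Finset.mul_sum]

/-- The real XY weight as a function of the spins times `sin(θ_x − θ_y)`: the function integrated by parts. -/
theorem cfw_G_exp [NeZero L] (J : ℝ) (x y : TorusSite 3 L) (θ : TorusSite 3 L → ℝ) :
    (((Circle.exp (θ y))⁻¹ * Circle.exp (θ x) : Circle) : ℂ).im *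
        ginibreWeight (fun b : Bond L => diffChar b.1 (b.1 + Pi.single b.2 1)) (fun _ => J) (fun v => Circle.exp (θ v)) =
      Real.sin (θ x - θ y) * Real.exp (J * ∑ b : Bond L, Real.cos (θ (b.1 + Pi.single b.2 1) - θ b.1)) := by
  rw [cfw_im_exp, cfw_ginibreWeight_exp]

/-- The one-coordinate rotation of `sin(θ_x − θ_y) w_J(θ)` and its `s`-derivative. -/
theorem cfw_hasDerivAt_rot [NeZero L] (J : ℝ) (x y : TorusSite 3 L) (e : TorusSite 3 L → ℝ) (θ : TorusSite 3 L → ℝ) (s : ℝ) :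
    HasDerivAt (fun s : ℝ => Real.sin ((θ x + s * e x) - (θ y + s * e y)) *
        Real.exp (J * ∑ b : Bond L, Real.cos ((θ (b.1 + Pi.single b.2 1) + s * e (b.1 + Pi.single b.2 1)) - (θ b.1 + s * e b.1))))
      (Real.cos ((θ x + s * e x) - (θ y + s * e y)) * (e x - e y) *
          Real.exp (J * ∑ b : Bond L, Real.cos ((θ (b.1 + Pi.single b.2 1) + s * e (b.1 + Pi.single b.2 1)) - (θ b.1 + s * e b.1))) +
        Real.sin ((θ x + s * e x) - (θ y + s * e y)) *
          (Real.exp (J * ∑ b : Bond L, Real.cos ((θ (b.1 + Pi.single b.2 1) + s * e (b.1 + Pi.single b.2 1)) - (θ b.1 + s * e b.1))) *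
            (J * ∑ b : Bond L, -Real.sin ((θ (b.1 + Pi.single b.2 1) + s * e (b.1 + Pi.single b.2 1)) - (θ b.1 + s * e b.1)) *
              (e (b.1 + Pi.single b.2 1) - e b.1)))) s := by
  -- the linear arguments
  have hlin : ∀ (a c : ℝ), HasDerivAt (fun s : ℝ => a + s * c) c s := by
    intro a c
    have h1 : HasDerivAt (fun s : ℝ => s * c) c s := hasDerivAt_mul_const c
    exact h1.const_add a
  have harg1 : HasDerivAt (fun s : ℝ => (θ x + s * e x) - (θ y + s * e y)) (e x - e y) s := by
    have := (hlin (θ x) (e x)).sub (hlin (θ y) (e y))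
    exact this
  have hsin := harg1.sin
  have hsum : HasDerivAt (fun s : ℝ => ∑ b : Bond L,
      Real.cos ((θ (b.1 + Pi.single b.2 1) + s * e (b.1 + Pi.single b.2 1)) - (θ b.1 + s * e b.1)))
      (∑ b : Bond L, -Real.sin ((θ (b.1 + Pi.single b.2 1) + s * e (b.1 + Pi.single b.2 1)) - (θ b.1 + s * e b.1)) *
        (e (b.1 + Pi.single b.2 1) - e b.1)) s := by
    refine HasDerivAt.fun_sum fun b _ => ?_
    exact ((hlin (θ (b.1 + Pi.single b.2 1)) (e (b.1 + Pi.single b.2 1))).sub (hlin (θ b.1) (e b.1))).cos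
  have hexp := (hsum.const_mul J).exp
  exact hsin.mul hexp

/-- STUB `stub_rotatorWardIdentity` (registered on stmt-HubbardSuperconductivity-10739, line `schwarz-inheritance`, rev 16): the **rotator
Ward identity** on the torus `(ℤ/Lℤ)³`: for `x ≠ y`,
`∫_cube cos(θ_x − θ_y) e^{J Σ_b cos ∇_bθ} dθ = J ∫_cube sin(θ_x − θ_y) S_x(θ) e^{J Σ_b cos ∇_bθ} dθ`,
`S_x(θ) = Σ_b sin(∇_bθ) (δ_{x,b₂} − δ_{x,b₁})` (`b = (b₁, b₂ = b₁ + e_i)`; `S_x = −∂_{θ_x} Σ_b cos ∇_bθ`) — integration by parts of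
`∂_{θ_x}[sin(θ_x − θ_y) w_J]` over the angle cube (periodicity kills the boundary term).  [folklore] -/
theorem stub_rotatorWardIdentity :
    ∀ (J : ℝ) (L : ℕ) [NeZero L] (x y : TorusSite 3 L), x ≠ y →
      (∫ θ in cube L, Real.cos (θ x - θ y) * Real.exp (J * ∑ b : Bond L, Real.cos (θ (b.1 + Pi.single b.2 1) - θ b.1))) =
        J * ∫ θ in cube L, Real.sin (θ x - θ y) *
          (∑ b : Bond L, Real.sin (θ (b.1 + Pi.single b.2 1) - θ b.1) *
            ((Pi.single x (1 : ℝ) : TorusSite 3 L → ℝ) (b.1 + Pi.single b.2 1) -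
              (Pi.single x (1 : ℝ) : TorusSite 3 L → ℝ) b.1)) *
          Real.exp (J * ∑ b : Bond L, Real.cos (θ (b.1 + Pi.single b.2 1) - θ b.1)) := by
  intro J L _ x y hxy
  set e : TorusSite 3 L → ℝ := Pi.single x (1 : ℝ) with he
  set w : (TorusSite 3 L → ℝ) → ℝ := fun θ =>
    Real.exp (J * ∑ b : Bond L, Real.cos (θ (b.1 + Pi.single b.2 1) - θ b.1)) with hw
  set S : (TorusSite 3 L → ℝ) → ℝ := fun θ =>
    ∑ b : Bond L, Real.sin (θ (b.1 + Pi.single b.2 1) - θ b.1) * (e (b.1 + Pi.single b.2 1) - e b.1) with hS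
  have hex : e x = 1 := by simp [he]
  have hey : e y = 0 := by simp [he, Pi.single_eq_of_ne hxy.symm]
  -- the derivative `D` of the rotated integrand at `s = 0`
  set D : (TorusSite 3 L → ℝ) → ℝ := fun θ =>
    Real.cos (θ x - θ y) * w θ - J * (Real.sin (θ x - θ y) * S θ * w θ) with hD
  set χ : Bond L → (TorusSite 3 L → Circle) →ₜ* Circle := fun b => diffChar b.1 (b.1 + Pi.single b.2 1) with hχ
  set G : (TorusSite 3 L → Circle) → ℝ := fun z =>
    (((z y)⁻¹ * z x : Circle) : ℂ).im * ginibreWeight χ (fun _ => J) z with hG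
  have hGc : Continuous G := by
    refine Continuous.mul ?_ (continuous_ginibreWeight χ _)
    exact Complex.continuous_im.comp (continuous_subtype_val.comp
      (((continuous_apply y).inv).mul (continuous_apply x)))
  have hwc : Continuous w := continuous_xyWeight J
  have hSc : Continuous S := by
    simp only [hS]
    fun_prop
  have hDc : Continuous D := by
    simp only [hD]
    fun_prop
  -- bound on `D`
  have hwb : ∀ θ, |w θ| ≤ Real.exp (|J| * ∑ _b : Bond L, (1 : ℝ)) := by
    intro θ
    have h := ent_norm_wJ_le (L := L) J θ
    unfold wJ at h
    rwa [Complex.norm_real, Real.norm_eq_abs] at h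
  have heb : ∀ v, |e v| ≤ 1 := by
    intro v
    simp only [he, Pi.single_apply]
    split_ifs <;> simp
  have hSb : ∀ θ, |S θ| ≤ ∑ _b : Bond L, (2 : ℝ) := by
    intro θ
    refine (Finset.abs_sum_le_sum_abs _ _).trans (Finset.sum_le_sum fun b _ => ?_)
    rw [abs_mul]
    have h1 : |Real.sin (θ (b.1 + Pi.single b.2 1) - θ b.1)| ≤ 1 := Real.abs_sin_le_one _
    have h2 : |e (b.1 + Pi.single b.2 1) - e b.1| ≤ 2 := by
      have := abs_sub (e (b.1 + Pi.single b.2 1)) (e b.1)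
      linarith [heb (b.1 + Pi.single b.2 1), heb b.1]
    calc |Real.sin (θ (b.1 + Pi.single b.2 1) - θ b.1)| * |e (b.1 + Pi.single b.2 1) - e b.1| ≤ 1 * 2 := by
          exact mul_le_mul h1 h2 (abs_nonneg _) zero_le_one
      _ = 2 := by norm_num
  have hK : ∀ θ, |D θ| ≤ Real.exp (|J| * ∑ _b : Bond L, (1 : ℝ)) * (1 + |J| * ∑ _b : Bond L, (2 : ℝ)) := by
    intro θ
    set W₀ := Real.exp (|J| * ∑ _b : Bond L, (1 : ℝ))
    have hw0 : 0 ≤ |w θ| := abs_nonneg _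
    have h1 : |Real.cos (θ x - θ y) * w θ| ≤ W₀ := by
      rw [abs_mul]
      calc |Real.cos (θ x - θ y)| * |w θ| ≤ 1 * |w θ| :=
            mul_le_mul_of_nonneg_right (Real.abs_cos_le_one _) hw0
        _ ≤ W₀ := by rw [one_mul]; exact hwb θ
    have h2 : |J * (Real.sin (θ x - θ y) * S θ * w θ)| ≤ |J| * ((∑ _b : Bond L, (2 : ℝ)) * W₀) := by
      rw [abs_mul, abs_mul, abs_mul]
      refine mul_le_mul_of_nonneg_left ?_ (abs_nonneg _)
      calc |Real.sin (θ x - θ y)| * |S θ| * |w θ| ≤ 1 * (∑ _b : Bond L, (2 : ℝ)) * W₀ := by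
            refine mul_le_mul (mul_le_mul (Real.abs_sin_le_one _) (hSb θ) (abs_nonneg _) zero_le_one) (hwb θ) hw0 ?_
            positivity
        _ = (∑ _b : Bond L, (2 : ℝ)) * W₀ := by ring
    calc |D θ| ≤ |Real.cos (θ x - θ y) * w θ| + |J * (Real.sin (θ x - θ y) * S θ * w θ)| := abs_sub _ _
      _ ≤ W₀ + |J| * ((∑ _b : Bond L, (2 : ℝ)) * W₀) := add_le_add h1 h2
      _ = W₀ * (1 + |J| * ∑ _b : Bond L, (2 : ℝ)) := by ring
  -- the derivative hypothesis
  have hderiv : ∀ θ : TorusSite 3 L → ℝ,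
      HasDerivAt (fun s : ℝ => G (fun v => Circle.exp (θ v + s * e v))) (D θ) 0 := by
    intro θ
    have hfun : (fun s : ℝ => G (fun v => Circle.exp (θ v + s * e v))) = fun s : ℝ =>
        Real.sin ((θ x + s * e x) - (θ y + s * e y)) *
          Real.exp (J * ∑ b : Bond L,
            Real.cos ((θ (b.1 + Pi.single b.2 1) + s * e (b.1 + Pi.single b.2 1)) - (θ b.1 + s * e b.1))) := by
      funext s
      exact cfw_G_exp J x y (fun v => θ v + s * e v)
    rw [hfun]
    have h := cfw_hasDerivAt_rot (L := L) J x y e θ 0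
    simp only [zero_mul, add_zero] at h
    convert h using 1
    simp only [hD, hw, hS, hex, hey, neg_mul, Finset.sum_neg_distrib]
    ring
  have hint0 := cfw_setIntegral_deriv_eq_zero x hGc hDc hK hderiv
  -- unpack `∫ D = 0`
  have hI1 : Integrable (fun θ => Real.cos (θ x - θ y) * w θ) (volume.restrict (cube L)) :=
    ((by fun_prop : Continuous fun θ : TorusSite 3 L → ℝ => Real.cos (θ x - θ y)).mul hwc).continuousOn.integrableOn_compact
      ent_isCompact_cube
  have hI2 : Integrable (fun θ => J * (Real.sin (θ x - θ y) * S θ * w θ)) (volume.restrict (cube L)) := by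
    refine (Continuous.continuousOn ?_).integrableOn_compact ent_isCompact_cube
    fun_prop
  have hsplit : ∫ θ in cube L, D θ = (∫ θ in cube L, Real.cos (θ x - θ y) * w θ) -
      J * ∫ θ in cube L, Real.sin (θ x - θ y) * S θ * w θ := by
    simp only [hD]
    rw [integral_sub hI1 hI2, integral_const_mul]
  rw [hsplit, sub_eq_zero] at hint0
  exact hint0


/-! ### D. Consequences used by the energy-tilt pinching -/

/-- Per-bond trigonometric identity behind `Σ_x sin(θ_x − c) S_x = Σ_b (cos(θ_{b₁} − c) + cos(θ_{b₂} − c))(1 − cos ∇_bθ)`. -/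
theorem cfw_trig (a b : ℝ) :
    Real.sin (b - a) * (Real.sin b - Real.sin a) = (Real.cos a + Real.cos b) * (1 - Real.cos (b - a)) := by
  have ha := Real.sin_sq_add_cos_sq a
  have hb := Real.sin_sq_add_cos_sq b
  rw [Real.sin_sub, Real.cos_sub]
  linear_combination (Real.cos a) * hb + (Real.cos b) * ha

/-- **The current–magnetisation observable is the Ward sum**: for every `θ` and `c`,
`Σ_x sin(θ_x − c) S_x(θ) = Σ_b (cos(θ_{b₁} − c) + cos(θ_{b₂} − c)) (1 − cos ∇_bθ)`. -/
theorem cfw_sum_sin_S [NeZero L] (θ : TorusSite 3 L → ℝ) (c : ℝ) :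
    ∑ x : TorusSite 3 L, Real.sin (θ x - c) *
        (∑ b : Bond L, Real.sin (θ (b.1 + Pi.single b.2 1) - θ b.1) *
          ((Pi.single x (1 : ℝ) : TorusSite 3 L → ℝ) (b.1 + Pi.single b.2 1) -
            (Pi.single x (1 : ℝ) : TorusSite 3 L → ℝ) b.1)) =
      ∑ b : Bond L, (Real.cos (θ b.1 - c) + Real.cos (θ (b.1 + Pi.single b.2 1) - c)) *
        (1 - Real.cos (θ (b.1 + Pi.single b.2 1) - θ b.1)) := by
  classical
  have hswap : ∑ x : TorusSite 3 L, Real.sin (θ x - c) *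
        (∑ b : Bond L, Real.sin (θ (b.1 + Pi.single b.2 1) - θ b.1) *
          ((Pi.single x (1 : ℝ) : TorusSite 3 L → ℝ) (b.1 + Pi.single b.2 1) -
            (Pi.single x (1 : ℝ) : TorusSite 3 L → ℝ) b.1)) =
      ∑ b : Bond L, Real.sin (θ (b.1 + Pi.single b.2 1) - θ b.1) *
        ∑ x : TorusSite 3 L, Real.sin (θ x - c) *
          ((Pi.single x (1 : ℝ) : TorusSite 3 L → ℝ) (b.1 + Pi.single b.2 1) -
            (Pi.single x (1 : ℝ) : TorusSite 3 L → ℝ) b.1) := by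
    simp_rw [Finset.mul_sum]
    rw [Finset.sum_comm]
    refine Finset.sum_congr rfl fun b _ => Finset.sum_congr rfl fun x _ => ?_
    ring
  rw [hswap]
  refine Finset.sum_congr rfl fun b _ => ?_
  have hδ : ∀ z : TorusSite 3 L, ∑ x : TorusSite 3 L, Real.sin (θ x - c) * (Pi.single x (1 : ℝ) : TorusSite 3 L → ℝ) z =
      Real.sin (θ z - c) := by
    intro z
    simp only [Pi.single_apply]
    simp
  have hsplit : ∑ x : TorusSite 3 L, Real.sin (θ x - c) *
      ((Pi.single x (1 : ℝ) : TorusSite 3 L → ℝ) (b.1 + Pi.single b.2 1) - (Pi.single x (1 : ℝ) : TorusSite 3 L → ℝ) b.1) =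
      Real.sin (θ (b.1 + Pi.single b.2 1) - c) - Real.sin (θ b.1 - c) := by
    simp_rw [mul_sub]
    rw [Finset.sum_sub_distrib, hδ, hδ]
  rw [hsplit]
  have := cfw_trig (θ b.1 - c) (θ (b.1 + Pi.single b.2 1) - c)
  rw [show θ (b.1 + Pi.single b.2 1) - c - (θ b.1 - c) = θ (b.1 + Pi.single b.2 1) - θ b.1 by ring] at this
  rw [this]

/-- **The Ward identity summed against the magnetisation**:
`J Σ_x Σ_y ∫ sin(θ_x − θ_y) S_x w_J = Σ_x Σ_y ∫ cos(θ_x − θ_y) w_J − |Λ| ∫ w_J`. -/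
theorem cfw_ward_sum [NeZero L] (J : ℝ) :
    J * ∑ x : TorusSite 3 L, ∑ y : TorusSite 3 L, ∫ θ in cube L, Real.sin (θ x - θ y) *
        (∑ b : Bond L, Real.sin (θ (b.1 + Pi.single b.2 1) - θ b.1) *
          ((Pi.single x (1 : ℝ) : TorusSite 3 L → ℝ) (b.1 + Pi.single b.2 1) -
            (Pi.single x (1 : ℝ) : TorusSite 3 L → ℝ) b.1)) *
        Real.exp (J * ∑ b : Bond L, Real.cos (θ (b.1 + Pi.single b.2 1) - θ b.1)) =
      (∑ x : TorusSite 3 L, ∑ y : TorusSite 3 L, ∫ θ in cube L, Real.cos (θ x - θ y) *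
        Real.exp (J * ∑ b : Bond L, Real.cos (θ (b.1 + Pi.single b.2 1) - θ b.1))) -
      (Fintype.card (TorusSite 3 L) : ℝ) *
        ∫ θ in cube L, Real.exp (J * ∑ b : Bond L, Real.cos (θ (b.1 + Pi.single b.2 1) - θ b.1)) := by
  classical
  set w : (TorusSite 3 L → ℝ) → ℝ := fun θ =>
    Real.exp (J * ∑ b : Bond L, Real.cos (θ (b.1 + Pi.single b.2 1) - θ b.1)) with hw
  have hterm : ∀ x y : TorusSite 3 L,
      J * ∫ θ in cube L, Real.sin (θ x - θ y) *
        (∑ b : Bond L, Real.sin (θ (b.1 + Pi.single b.2 1) - θ b.1) *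
          ((Pi.single x (1 : ℝ) : TorusSite 3 L → ℝ) (b.1 + Pi.single b.2 1) -
            (Pi.single x (1 : ℝ) : TorusSite 3 L → ℝ) b.1)) * w θ =
      (∫ θ in cube L, Real.cos (θ x - θ y) * w θ) - if x = y then ∫ θ in cube L, w θ else 0 := by
    intro x y
    by_cases hxy : x = y
    · subst hxy
      simp only [sub_self, Real.sin_zero, zero_mul, integral_zero, mul_zero, Real.cos_zero, one_mul, if_true]
    · rw [if_neg hxy, sub_zero]
      exact (stub_rotatorWardIdentity J L x y hxy).symm
  have hx : ∀ x : TorusSite 3 L,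
      J * ∑ y : TorusSite 3 L, ∫ θ in cube L, Real.sin (θ x - θ y) *
        (∑ b : Bond L, Real.sin (θ (b.1 + Pi.single b.2 1) - θ b.1) *
          ((Pi.single x (1 : ℝ) : TorusSite 3 L → ℝ) (b.1 + Pi.single b.2 1) -
            (Pi.single x (1 : ℝ) : TorusSite 3 L → ℝ) b.1)) * w θ =
      (∑ y : TorusSite 3 L, ∫ θ in cube L, Real.cos (θ x - θ y) * w θ) - ∫ θ in cube L, w θ := by
    intro x
    rw [Finset.mul_sum, Finset.sum_congr rfl fun y _ => hterm x y, Finset.sum_sub_distrib, Finset.sum_ite_eq]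
    simp
  rw [Finset.mul_sum, Finset.sum_congr rfl fun x _ => hx x, Finset.sum_sub_distrib]
  simp only [Finset.sum_const, Finset.card_univ, nsmul_eq_mul]
  rfl

end Summit.HubbardSuperconductivity.HubbardSuperconductivity.Theorems.PerturbedXYOrder

end
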